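import Mathlib
import HarnessLib
import Summits.Ventures.LatticeQCDFlow.Scaling.AcceptanceEssEightNinthsDensities
import Summits.Ventures.LatticeQCDFlow.Scaling.AcceptanceEssEightNinthsRigidity

/-!
# LatticeQCDFlow / Scaling — the `acc ≥ (8/9)·ESS` law on a general space, V: rigidity in row 2's
# densities — `ā = (8/9)·κ` iff the model mass of `{w/q > t}` is `(4Z²/(3W₂) − (8Z³/(9W₂²))·t)₊`

HONEST FRAMING: exact (Metropolis-corrected) sampling algorithms for lattice gauge theory;
figures of merit are autocorrelation/cost numbers at stated couplings and volumes; no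
continuum-physics claim.

Venture `LatticeQCDFlow` (cell pub-lqcd), topic `Scaling`; FANOUT row 3 (`s0-u1-a`, S0-B
implementation A, GEN-12).  NEW WORK of the cell, not a published result; NO definition is
introduced.  Part II (`Scaling/AcceptanceEssEightNinthsDensities`, imported) specialised the
layer-cake core to row 2's vocabulary — `(X, μ)` s-finite, `w, q > 0` measurable, `w` integrable,
`∫ q dμ = 1`, `Z = ∫ w dμ`, `b = w/q`, `W₂ = ∫ b w dμ < ∞`, `κ = Z²/W₂`, `λ = rejCurve μ w q` — as
`ā ≥ (8/9)·κ`.  Part IV (`Scaling/AcceptanceEssEightNinthsRigidity`, imported) settled the equality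
case of the core.  Here the two are combined: the same conversions (`ofReal` of Bochner integrals,
row 2's `integrable_min_mul`, `integrable_integral_min_mul`, `meanAccept_eq`, `integral_pos_of_pos`)
carry the rigidity statement over to real integrals.

* `lintegral_survival_eq_ofReal` — `∫⁻ 𝟙(t < w/q)·q = ofReal (∫ 1[t < w/q] q dμ)` (the model mass
  of the super-level set of the weight, as a Bochner integral);
* **`integral_integral_min_mul_eq_eight_ninths_iff`** — `∫∫ min(w(x)q(y), w(y)q(x)) = (8/9)·Z³/W₂`
  iff for every `t > 0`, `∫ 1[t < w/q] q dμ = max (4Z²/(3W₂) − (8Z³/(9W₂²))·t) 0`;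
* **`meanAccept_eq_eight_ninths_ESS_iff`** — the same for the equilibrium acceptance
  `ā·Z = ∫ (1 − λ(b)) w dμ` of the exact flow / independence sampler (row 2's `rejCurve` form).

Reading for S0-A/S0-B (value-free): normalise `Z = 1`, `κ = ESS = 1/W₂`.  The acceptance–ESS
consistency floor `ā ≥ (8/9)·κ` of an exact flow sampler is attained precisely when the model
mass of `{w/q > t}` is `(4κ/3 − (8κ²/9)·t)₊` for every `t > 0` — the weight law under the model is
an atom at `0` of mass `1 − 4κ/3` plus a flat density `8κ²/9` on `(0, 3/(2κ)]`; for a sampler with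
everywhere-positive densities (no atom at weight `0`, e.g. row 2's φ⁴ flow) this forces `κ = 3/4`
and a uniform weight law on `(0, 2]`, and every other exact flow sampler accepts strictly more
often than `(8/9)·κ`.  NOT CLAIMED: any acceptance or ESS of ours; nothing re-scored.
-/

namespace Summit.Ventures.LatticeQCDFlow.Theory2

open MeasureTheory ENNReal Set
open Summit.Ventures.LatticeQCDFlow.Exactness

section Densities

variable {X : Type*} [MeasurableSpace X] {μ : Measure X} [SFinite μ] {w q : X → ℝ}

omit [SFinite μ] in
/-- **The model mass of `{t < w/q}` as a Bochner integral**: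
`∫⁻ 𝟙(t < w x/q x)·ofReal (q x) dμ = ofReal (∫ 1[t < w/q] q dμ)` (`q > 0` integrable). [folklore] -/
theorem lintegral_survival_eq_ofReal (hwm : Measurable w) (hq0 : ∀ t, 0 < q t)
    (hqm : Measurable q) (hqi : Integrable q μ) (t : ℝ) :
    ∫⁻ x, (Iio (w x / q x)).indicator (1 : ℝ → ℝ≥0∞) t * ENNReal.ofReal (q x) ∂μ
      = ENNReal.ofReal (∫ x, (if t < w x / q x then q x else 0) ∂μ) := by
  have hSm : MeasurableSet {x | t < w x / q x} := measurableSet_lt measurable_const (hwm.div hqm)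
  have hint : Integrable (fun x => if t < w x / q x then q x else 0) μ := by
    refine Integrable.mono' hqi ((Measurable.ite hSm hqm measurable_const).aestronglyMeasurable)
      (Filter.Eventually.of_forall fun x => ?_)
    by_cases h : t < w x / q x
    · rw [if_pos h, Real.norm_of_nonneg (hq0 x).le]
    · rw [if_neg h, norm_zero]; exact (hq0 x).le
  rw [ofReal_integral_eq_lintegral_ofReal hint (Filter.Eventually.of_forall fun x => by
    by_cases h : t < w x / q x
    · simp only [if_pos h]; exact (hq0 x).le
    · simp only [if_neg h]; exact le_rfl)]
  refine lintegral_congr fun x => ?_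
  simp only [Set.indicator_apply, mem_Iio, Pi.one_apply]
  by_cases h : t < w x / q x
  · rw [if_pos h, if_pos h, one_mul]
  · rw [if_neg h, if_neg h, zero_mul, ENNReal.ofReal_zero]

/-- **RIGIDITY OF `acc ≥ (8/9)·ESS` IN ROW 2's DENSITIES.**  For measurable `w, q > 0` with `w`
integrable, `∫ q dμ = 1`, `W₂ = ∫ (w/q)·w dμ < ∞`, `Z = ∫ w dμ`:
`∫∫ min(w(x)q(y), w(y)q(x)) = (8/9)·Z³/W₂` if and only if for every `t > 0` the model mass of
`{w/q > t}` is `max (4Z²/(3W₂) − (8Z³/(9W₂²))·t) 0`. [ours] -/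
theorem integral_integral_min_mul_eq_eight_ninths_iff (hw0 : ∀ t, 0 < w t) (hwm : Measurable w)
    (hwi : Integrable w μ) (hq0 : ∀ t, 0 < q t) (hqm : Measurable q) (hqi : Integrable q μ)
    (hq1 : ∫ z, q z ∂μ = 1) (hW₂ : Integrable (fun x => w x / q x * w x) μ) :
    ∫ x, ∫ y, min (w x * q y) (w y * q x) ∂μ ∂μ
        = 8 * (∫ z, w z ∂μ) ^ 3 / (9 * ∫ z, w z / q z * w z ∂μ)
      ↔ ∀ t : ℝ, 0 < t → ∫ x, (if t < w x / q x then q x else 0) ∂μ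
          = max (4 * (∫ z, w z ∂μ) ^ 2 / (3 * ∫ z, w z / q z * w z ∂μ)
              - 8 * (∫ z, w z ∂μ) ^ 3 / (9 * (∫ z, w z / q z * w z ∂μ) ^ 2) * t) 0 := by
  set Z : ℝ := ∫ z, w z ∂μ with hZdef
  set W : ℝ := ∫ z, w z / q z * w z ∂μ with hWdef
  have hZ : 0 < Z := integral_pos_of_pos hw0 hwi hq1
  have hb0 : ∀ x, 0 ≤ w x / q x := fun x => (div_pos (hw0 x) (hq0 x)).le
  have hW : 0 < W := integral_pos_of_pos (fun x => mul_pos (div_pos (hw0 x) (hq0 x)) (hw0 x)) hW₂ hq1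
  -- the two moments of the core, in real form (as in Part II)
  have hm1 : ∫⁻ x, ENNReal.ofReal (w x / q x) * ENNReal.ofReal (q x) ∂μ = ENNReal.ofReal Z := by
    rw [hZdef, ofReal_integral_eq_lintegral_ofReal hwi (Filter.Eventually.of_forall fun x => (hw0 x).le)]
    refine lintegral_congr fun x => ?_
    rw [← ENNReal.ofReal_mul (hb0 x), div_mul_cancel₀ _ (hq0 x).ne']
  have hm2 : ∫⁻ x, ENNReal.ofReal ((w x / q x) ^ 2) * ENNReal.ofReal (q x) ∂μ = ENNReal.ofReal W := by
    rw [hWdef, ofReal_integral_eq_lintegral_ofReal hW₂ (Filter.Eventually.of_forall fun x =>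
      (mul_pos (div_pos (hw0 x) (hq0 x)) (hw0 x)).le)]
    refine lintegral_congr fun x => ?_
    rw [← ENNReal.ofReal_mul (sq_nonneg _)]
    congr 1
    have hqx := (hq0 x).ne'
    field_simp
  have hmin0 : ∀ x y, 0 ≤ min (w x * q y) (w y * q x) := fun x y =>
    le_min (mul_nonneg (hw0 x).le (hq0 y).le) (mul_nonneg (hw0 y).le (hq0 x).le)
  have hO0 : 0 ≤ ∫ x, ∫ y, min (w x * q y) (w y * q x) ∂μ ∂μ :=
    integral_nonneg fun x => integral_nonneg fun y => hmin0 x y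
  -- the overlap, in real form (as in Part II)
  have hA : ∫⁻ x, ∫⁻ y, ENNReal.ofReal (min (w x / q x) (w y / q y)) * ENNReal.ofReal (q x)
        * ENNReal.ofReal (q y) ∂μ ∂μ
      = ENNReal.ofReal (∫ x, ∫ y, min (w x * q y) (w y * q x) ∂μ ∂μ) := by
    rw [ofReal_integral_eq_lintegral_ofReal (integrable_integral_min_mul (fun x => (hw0 x).le) hwm
      hwi (fun x => (hq0 x).le) hqm hqi hq1) (Filter.Eventually.of_forall fun x =>
        integral_nonneg fun y => hmin0 x y)]
    refine lintegral_congr fun x => ?_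
    rw [ofReal_integral_eq_lintegral_ofReal (integrable_min_mul (fun x => (hw0 x).le) hwm
      (fun x => (hq0 x).le) hqm hqi x) (Filter.Eventually.of_forall fun y => hmin0 x y)]
    refine lintegral_congr fun y => ?_
    rw [← ENNReal.ofReal_mul (le_min (hb0 x) (hb0 y)), ← ENNReal.ofReal_mul
      (mul_nonneg (le_min (hb0 x) (hb0 y)) (hq0 x).le)]
    congr 1
    rw [min_mul_of_nonneg _ _ (hq0 x).le, min_mul_of_nonneg _ _ (hq0 y).le]
    have hqx := (hq0 x).ne'
    have hqy := (hq0 y).ne'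
    congr 1
    · field_simp
    · field_simp
  -- the core rigidity, transported
  have hcore := overlap_eq_eight_ninths_iff (μ := μ) (b := fun x => w x / q x)
    (ρ := fun x => ENNReal.ofReal (q x)) (hwm.div hqm) hb0 hqm.ennreal_ofReal hZ hW hm1 hm2
  rw [hA, ENNReal.ofReal_eq_ofReal_iff hO0 (by positivity)] at hcore
  rw [hcore]
  refine forall_congr' fun t => imp_congr_right fun ht => ?_
  rw [lintegral_survival_eq_ofReal hwm hq0 hqm hqi t]
  have hS0 : 0 ≤ ∫ x, (if t < w x / q x then q x else 0) ∂μ :=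
    integral_nonneg fun x => by
      by_cases h : t < w x / q x
      · simp only [if_pos h]; exact (hq0 x).le
      · simp only [if_neg h]; exact le_rfl
  have e : ENNReal.ofReal (4 * Z ^ 2 / (3 * W) - 8 * Z ^ 3 / (9 * W ^ 2) * t)
      = ENNReal.ofReal (max (4 * Z ^ 2 / (3 * W) - 8 * Z ^ 3 / (9 * W ^ 2) * t) 0) := by
    rcases le_total (4 * Z ^ 2 / (3 * W) - 8 * Z ^ 3 / (9 * W ^ 2) * t) 0 with h | h
    · rw [max_eq_right h, ENNReal.ofReal_of_nonpos h, ENNReal.ofReal_zero]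
    · rw [max_eq_left h]
  rw [e, ENNReal.ofReal_eq_ofReal_iff hS0 (le_max_right _ _)]

/-- **`ā = (8/9)·κ` iff the weight law is the zero-inflated flat law** (row 2's `rejCurve` form):
under the same hypotheses, `∫ (1 − λ(b)) w dμ = (8/9)·Z³/W₂` if and only if for every `t > 0`
the model mass of `{w/q > t}` is `max (4Z²/(3W₂) − (8Z³/(9W₂²))·t) 0`. [ours] -/
theorem meanAccept_eq_eight_ninths_ESS_iff (hw0 : ∀ t, 0 < w t) (hwm : Measurable w)
    (hwi : Integrable w μ) (hq0 : ∀ t, 0 < q t) (hqm : Measurable q) (hqi : Integrable q μ)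
    (hq1 : ∫ z, q z ∂μ = 1) (hW₂ : Integrable (fun x => w x / q x * w x) μ) :
    ∫ x, (1 - rejCurve μ w q (w x / q x)) * w x ∂μ
        = 8 * (∫ z, w z ∂μ) ^ 3 / (9 * ∫ z, w z / q z * w z ∂μ)
      ↔ ∀ t : ℝ, 0 < t → ∫ x, (if t < w x / q x then q x else 0) ∂μ
          = max (4 * (∫ z, w z ∂μ) ^ 2 / (3 * ∫ z, w z / q z * w z ∂μ)
              - 8 * (∫ z, w z ∂μ) ^ 3 / (9 * (∫ z, w z / q z * w z ∂μ) ^ 2) * t) 0 := by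
  rw [← integral_integral_min_mul_eq_eight_ninths_iff hw0 hwm hwi hq0 hqm hqi hq1 hW₂,
    meanAccept_eq hw0 hq0]
  have hinner : ∀ x, ∫ y, min 1 (w y * q x / (w x * q y)) * q y ∂μ
      = 1 - rejCurve μ w q (w x / q x) := by
    intro x
    have hbx : 0 < w x / q x := div_pos (hw0 x) (hq0 x)
    have hint := integrable_rejCurve_integrand hw0 hwm hq0 hqm hqi hbx (μ := μ)
    have e : ∀ y, min 1 (w y * q x / (w x * q y)) * q y
        = q y - (1 - min 1 (w y / q y / (w x / q x))) * q y := by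
      intro y
      have hqy := (hq0 y).ne'
      have hqx := (hq0 x).ne'
      have hwx := (hw0 x).ne'
      have e1 : w y * q x / (w x * q y) = w y / q y / (w x / q x) := by
        field_simp
      rw [e1]
      ring
    simp_rw [e]
    rw [integral_sub hqi hint, hq1]
    rfl
  simp_rw [hinner]

end Densities

end Summit.Ventures.LatticeQCDFlow.Theory2
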